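import Mathlib
import Summits.Ventures.PercRepro2.Defs
import Summits.Ventures.PercRepro2.Independence
import Summits.Ventures.PercRepro2.Harris
import Summits.Ventures.PercRepro2.Graph
import Summits.Ventures.PercRepro2.Events
import Summits.Ventures.PercRepro2.BoxUnionDefs
import Summits.Ventures.PercRepro2.BoxUnion

/-!
# The box-union inequality on the two-cluster (Z)-lattice: the conditional (Z)-reading of the
union row (blind cell PercRepro2, mine-1 g38; conjectures/MINE-1.md §51, paper level in
proofs/MINE1-BOXUNION.md)

Fix a finite graph `ends : E → Sym2 V`, two vertices `s t` and an observed vertex set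
`F : Finset V`.  On the event `Q = {s ↮ t}` the pair of **statuses**
`σ(ω) = (C_s(ω) ∩ F, C_t(ω) ∩ F)` lives in the (Z)-lattice `ZLat V = Finset V × (Finset V)ᵒᵈ`
(`⊆` on the first coordinate, `⊇` on the second — van den Berg–Häggström–Kahn's order: a function
is (Z)-increasing iff it is increasing in `C_s` and decreasing in `C_t`).  The law of `σ` on `Q`
is `pairLaw p ends F s t : ZLat V → ℝ` (the two-cluster status law on `F`).

The union event `{s ↮ X} ∪ {t ↮ Y}` is a **box union** of this lattice:
`{C_s ∩ X = ∅} = ↓(Xᶜ, ∅)` and `{C_t ∩ Y = ∅} = ↑(∅, Yᶜ)` (`mem_boxUnion_iff`).  Hence the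
lattice theorem `BoxUnion.boxUnion_nonneg` applies whenever the status law is log-supermodular on
`ZLat V`, and gives (`pair_boxUnion_nonneg`, `hit_boxUnion_nonneg`):

`E[ (f(σ) − E[f(σ) | Q]) (g(σ) − E[g(σ) | Q]) · 1_{Q ∩ ({s ↮ X} ∪ {t ↮ Y})} ] ≥ 0`

for all (Z)-increasing `f g` of the statuses and all `X Y ⊆ F`.  The hypothesis is a genuine
restriction: the two-cluster law is NOT log-supermodular on `ZLat V` in general (MINE-1.md §43),
so this is a CONDITIONAL result — the row holds on every instance whose status law is
log-supermodular, and the theorem records exactly which instances the box-union mechanism covers.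
-/

namespace Summit.Ventures.PercRepro2

namespace BoxUnionPair

open Finset
open scoped Classical

/-- The (Z)-lattice of the two-cluster statuses: pairs `(C_s, C_t)` with `⊆` on the first and
`⊇` on the second coordinate (a finite distributive lattice). -/
abbrev ZLat (V : Type*) := Finset V × (Finset V)ᵒᵈ

variable {V : Type*} {E : Type*} [Fintype V] [DecidableEq V] [Fintype E] [DecidableEq E]

/-- The status pair `(C_s ∩ F, C_t ∩ F)` of the two clusters on the observed set `F`, as a point
of the (Z)-lattice. -/
noncomputable def status (ends : E → Sym2 V) (F : Finset V) (s t : V) (ω : Config E) : ZLat V :=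
  (F.filter (fun u => Conn ends ω s u), OrderDual.toDual (F.filter (fun u => Conn ends ω t u)))

omit [DecidableEq E] in
/-- The first status is the hit set of `s` in `F`. -/
lemma status_fst (ends : E → Sym2 V) (F : Finset V) (s t : V) (ω : Config E) :
    (status ends F s t ω).1 = F.filter (fun u => Conn ends ω s u) := rfl

omit [DecidableEq E] in
/-- The second status is the hit set of `t` in `F`. -/
lemma status_snd (ends : E → Sym2 V) (F : Finset V) (s t : V) (ω : Config E) :
    OrderDual.ofDual (status ends F s t ω).2 = F.filter (fun u => Conn ends ω t u) := rfl

/-- The two-cluster status law on `F`, restricted to `Q = {s ↮ t}`: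
`pairLaw k = P(σ = k, s ↮ t)`. -/
noncomputable def pairLaw (p : E → ℝ) (ends : E → Sym2 V) (F : Finset V) (s t : V)
    (k : ZLat V) : ℝ :=
  ∑ ω, if status ends F s t ω = k ∧ ω ∈ (connEvent ends s t)ᶜ then weight p ω else 0

/-- The conditional mean `E[h(σ) | s ↮ t]` of a function of the statuses. -/
noncomputable def condMean (p : E → ℝ) (ends : E → Sym2 V) (F : Finset V) (s t : V)
    (h : ZLat V → ℝ) : ℝ :=
  (∑ ω, if ω ∈ (connEvent ends s t)ᶜ then weight p ω * h (status ends F s t ω) else 0) /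
    prob p (connEvent ends s t)ᶜ

variable {p : E → ℝ} (ends : E → Sym2 V) (F : Finset V) (s t : V)

/-- The status law is nonnegative. -/
lemma pairLaw_nonneg (hp : IsProbVec p) (k : ZLat V) : 0 ≤ pairLaw p ends F s t k :=
  sum_nonneg fun ω _ => by
    split_ifs
    · exact weight_nonneg hp ω
    · exact le_rfl

/-- The pushforward identity: sums against the status law are expectations on `Q`. -/
lemma sum_pairLaw_mul (h : ZLat V → ℝ) :
    ∑ k, pairLaw p ends F s t k * h k =
      ∑ ω, if ω ∈ (connEvent ends s t)ᶜ then weight p ω * h (status ends F s t ω) else 0 := by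
  unfold pairLaw
  simp_rw [Finset.sum_mul]
  rw [Finset.sum_comm]
  refine Finset.sum_congr rfl fun ω _ => ?_
  by_cases hQ : ω ∈ (connEvent ends s t)ᶜ
  · simp only [hQ, and_true, if_true, ite_mul, zero_mul, Finset.sum_ite_eq, Finset.mem_univ]
  · simp only [hQ, and_false, if_false, zero_mul, Finset.sum_const_zero]

/-- The total mass of the status law is `P(s ↮ t)`. -/
lemma sum_pairLaw : ∑ k, pairLaw p ends F s t k = prob p (connEvent ends s t)ᶜ := by
  have h := sum_pairLaw_mul (p := p) ends F s t (fun _ => 1)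
  simp only [mul_one] at h
  rw [h]
  unfold prob
  refine Finset.sum_congr rfl fun ω _ => ?_
  by_cases hQ : ω ∈ (connEvent ends s t)ᶜ
  · rw [if_pos hQ, Set.indicator_of_mem hQ]
  · rw [if_neg hQ, Set.indicator_of_notMem hQ]

/-- The lattice mean with respect to the status law is the conditional mean given `s ↮ t`. -/
lemma mean_pairLaw (h : ZLat V → ℝ) :
    BoxUnion.mean (pairLaw p ends F s t) h = condMean p ends F s t h := by
  unfold BoxUnion.mean condMean
  rw [sum_pairLaw_mul, sum_pairLaw]

omit [Fintype V] [DecidableEq V] in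
/-- A function increasing in `C_s` and decreasing in `C_t` is monotone on the (Z)-lattice. -/
lemma monotone_zfun {f : Finset V → Finset V → ℝ}
    (hf : ∀ ⦃W W' C C' : Finset V⦄, W ⊆ W' → C' ⊆ C → f W C ≤ f W' C') :
    Monotone (fun k : ZLat V => f k.1 (OrderDual.ofDual k.2)) :=
  fun _ _ hk => hf hk.1 hk.2

/-- The union event `{C_s ∩ X = ∅} ∪ {C_t ∩ Y = ∅}` is the box union `↓(Xᶜ, ∅) ∪ ↑(∅, Yᶜ)` of
the (Z)-lattice. -/
lemma mem_boxUnion_iff (X Y : Finset V) (k : ZLat V) :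
    k ∈ BoxUnion.boxUnion ((Xᶜ, OrderDual.toDual (∅ : Finset V)) : ZLat V)
        (((∅ : Finset V), OrderDual.toDual Yᶜ) : ZLat V) ↔
      k.1 ∩ X = ∅ ∨ OrderDual.ofDual k.2 ∩ Y = ∅ := by
  rw [BoxUnion.mem_boxUnion, Prod.le_def, Prod.le_def]
  simp only [OrderDual.le_toDual, OrderDual.toDual_le, Finset.empty_subset, and_true, true_and,
    Finset.subset_compl_iff_disjoint_right, Finset.disjoint_iff_inter_eq_empty]

/-- **The (Z)-reading of the union row, conditional on log-supermodularity of the status law.**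
If the two-cluster status law on `F` is log-supermodular on the (Z)-lattice and `P(s ↮ t) > 0`,
then for all `f g` increasing in `C_s` and decreasing in `C_t` and all `X Y`,
`E[(f(σ) − E[f(σ) | Q]) (g(σ) − E[g(σ) | Q]) · 1_{Q ∩ ({C_s ∩ X = ∅} ∪ {C_t ∩ Y = ∅})}] ≥ 0`,
`Q = {s ↮ t}`. -/
theorem pair_boxUnion_nonneg (hp : IsProbVec p)
    (hlsm : ∀ x y : ZLat V, pairLaw p ends F s t x * pairLaw p ends F s t y ≤
      pairLaw p ends F s t (x ⊓ y) * pairLaw p ends F s t (x ⊔ y))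
    (hQ : 0 < prob p (connEvent ends s t)ᶜ) {f g : Finset V → Finset V → ℝ}
    (hf : ∀ ⦃W W' C C' : Finset V⦄, W ⊆ W' → C' ⊆ C → f W C ≤ f W' C')
    (hg : ∀ ⦃W W' C C' : Finset V⦄, W ⊆ W' → C' ⊆ C → g W C ≤ g W' C') (X Y : Finset V) :
    0 ≤ ∑ ω, if ω ∈ (connEvent ends s t)ᶜ ∧
        ((status ends F s t ω).1 ∩ X = ∅ ∨ OrderDual.ofDual (status ends F s t ω).2 ∩ Y = ∅) then
      weight p ω *
        ((f (status ends F s t ω).1 (OrderDual.ofDual (status ends F s t ω).2) -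
            condMean p ends F s t (fun k => f k.1 (OrderDual.ofDual k.2))) *
          (g (status ends F s t ω).1 (OrderDual.ofDual (status ends F s t ω).2) -
            condMean p ends F s t (fun k => g k.1 (OrderDual.ofDual k.2))))
      else 0 := by
  have key := BoxUnion.boxUnion_nonneg (ν := pairLaw p ends F s t)
    (a := ((Xᶜ, OrderDual.toDual (∅ : Finset V)) : ZLat V))
    (b := (((∅ : Finset V), OrderDual.toDual Yᶜ) : ZLat V))
    (pairLaw_nonneg ends F s t hp) hlsm (by rw [sum_pairLaw]; exact hQ)
    (monotone_zfun hf) (monotone_zfun hg)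
  rw [mean_pairLaw, mean_pairLaw] at key
  set φ : ZLat V → ℝ := fun k =>
    (f k.1 (OrderDual.ofDual k.2) - condMean p ends F s t (fun k => f k.1 (OrderDual.ofDual k.2))) *
      (g k.1 (OrderDual.ofDual k.2) - condMean p ends F s t (fun k => g k.1 (OrderDual.ofDual k.2)))
    with hφ
  have hsplit : (∑ k, if k ∈ BoxUnion.boxUnion ((Xᶜ, OrderDual.toDual (∅ : Finset V)) : ZLat V)
        (((∅ : Finset V), OrderDual.toDual Yᶜ) : ZLat V) then pairLaw p ends F s t k * φ k
        else 0) =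
      ∑ k, pairLaw p ends F s t k *
        (if k.1 ∩ X = ∅ ∨ OrderDual.ofDual k.2 ∩ Y = ∅ then φ k else 0) := by
    refine Finset.sum_congr rfl fun k _ => ?_
    rw [mem_boxUnion_iff]
    split_ifs
    · rfl
    · rw [mul_zero]
  rw [hsplit, sum_pairLaw_mul] at key
  refine le_of_le_of_eq key (Finset.sum_congr rfl fun ω _ => ?_)
  by_cases hQω : ω ∈ (connEvent ends s t)ᶜ
  · by_cases hU : (status ends F s t ω).1 ∩ X = ∅ ∨
        OrderDual.ofDual (status ends F s t ω).2 ∩ Y = ∅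
    · rw [if_pos hQω, if_pos hU, if_pos ⟨hQω, hU⟩]
    · rw [if_pos hQω, if_neg hU, if_neg (fun h => hU h.2), mul_zero]
  · rw [if_neg hQω, if_neg (fun h => hQω h.1)]

omit [DecidableEq E] in
/-- For `X ⊆ F` the status condition `C_s ∩ F ∩ X = ∅` is the avoidance event `s ↮ X`. -/
lemma status_fst_inter_eq_empty_iff {X : Finset V} (hX : X ⊆ F) (ω : Config E) :
    (status ends F s t ω).1 ∩ X = ∅ ↔ ω ∉ hitEvent ends s X := by
  rw [status_fst, Finset.eq_empty_iff_forall_notMem, mem_hitEvent]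
  constructor
  · rintro h ⟨a, ha, hc⟩
    exact h a (Finset.mem_inter.mpr ⟨Finset.mem_filter.mpr ⟨hX ha, hc⟩, ha⟩)
  · intro h a ha
    rw [Finset.mem_inter, Finset.mem_filter] at ha
    exact h ⟨a, ha.2, ha.1.2⟩

omit [DecidableEq E] in
/-- For `Y ⊆ F` the status condition `C_t ∩ F ∩ Y = ∅` is the avoidance event `t ↮ Y`. -/
lemma status_snd_inter_eq_empty_iff {Y : Finset V} (hY : Y ⊆ F) (ω : Config E) :
    OrderDual.ofDual (status ends F s t ω).2 ∩ Y = ∅ ↔ ω ∉ hitEvent ends t Y := by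
  rw [status_snd, Finset.eq_empty_iff_forall_notMem, mem_hitEvent]
  constructor
  · rintro h ⟨a, ha, hc⟩
    exact h a (Finset.mem_inter.mpr ⟨Finset.mem_filter.mpr ⟨hY ha, hc⟩, ha⟩)
  · intro h a ha
    rw [Finset.mem_inter, Finset.mem_filter] at ha
    exact h ⟨a, ha.2, ha.1.2⟩

/-- **The union row in percolation vocabulary** (conditional on log-supermodularity of the
status law): for `X Y ⊆ F`, `f g` (Z)-increasing functions of the statuses,
`E[ (f(σ) − E[f(σ) | Q]) (g(σ) − E[g(σ) | Q]) · 1_{Q ∩ ({s ↮ X} ∪ {t ↮ Y})} ] ≥ 0`,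
`Q = {s ↮ t}`, written with `expect` and an indicator. -/
theorem hit_boxUnion_nonneg (hp : IsProbVec p)
    (hlsm : ∀ x y : ZLat V, pairLaw p ends F s t x * pairLaw p ends F s t y ≤
      pairLaw p ends F s t (x ⊓ y) * pairLaw p ends F s t (x ⊔ y))
    (hQ : 0 < prob p (connEvent ends s t)ᶜ) {f g : Finset V → Finset V → ℝ}
    (hf : ∀ ⦃W W' C C' : Finset V⦄, W ⊆ W' → C' ⊆ C → f W C ≤ f W' C')
    (hg : ∀ ⦃W W' C C' : Finset V⦄, W ⊆ W' → C' ⊆ C → g W C ≤ g W' C')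
    {X Y : Finset V} (hX : X ⊆ F) (hY : Y ⊆ F) :
    0 ≤ expect p (((connEvent ends s t)ᶜ ∩ ((hitEvent ends s X)ᶜ ∪ (hitEvent ends t Y)ᶜ)).indicator
      (fun ω =>
        (f (status ends F s t ω).1 (OrderDual.ofDual (status ends F s t ω).2) -
            condMean p ends F s t (fun k => f k.1 (OrderDual.ofDual k.2))) *
          (g (status ends F s t ω).1 (OrderDual.ofDual (status ends F s t ω).2) -
            condMean p ends F s t (fun k => g k.1 (OrderDual.ofDual k.2))))) := by
  refine le_of_le_of_eq (pair_boxUnion_nonneg ends F s t hp hlsm hQ hf hg X Y) ?_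
  unfold expect
  refine Finset.sum_congr rfl fun ω _ => ?_
  have hmem : (ω ∈ (connEvent ends s t)ᶜ ∧
      ((status ends F s t ω).1 ∩ X = ∅ ∨ OrderDual.ofDual (status ends F s t ω).2 ∩ Y = ∅)) ↔
      ω ∈ (connEvent ends s t)ᶜ ∩ ((hitEvent ends s X)ᶜ ∪ (hitEvent ends t Y)ᶜ) := by
    rw [status_fst_inter_eq_empty_iff ends F s t hX, status_snd_inter_eq_empty_iff ends F s t hY]
    simp only [Set.mem_inter_iff, Set.mem_union, Set.mem_compl_iff]
  by_cases h : ω ∈ (connEvent ends s t)ᶜ ∩ ((hitEvent ends s X)ᶜ ∪ (hitEvent ends t Y)ᶜ)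
  · rw [if_pos (hmem.mpr h), Set.indicator_of_mem h]
  · rw [if_neg (fun h' => h (hmem.mp h')), Set.indicator_of_notMem h, mul_zero]

/-- The full-cluster case `F = univ` (MINE-1.md §51 (i)): if the law of `(C_s, C_t)` on
`{s ↮ t}` is log-supermodular on the (Z)-lattice, the union row holds for all `X Y` and all
(Z)-increasing `f g` of the two clusters. -/
theorem hit_boxUnion_nonneg_univ (hp : IsProbVec p)
    (hlsm : ∀ x y : ZLat V, pairLaw p ends univ s t x * pairLaw p ends univ s t y ≤
      pairLaw p ends univ s t (x ⊓ y) * pairLaw p ends univ s t (x ⊔ y))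
    (hQ : 0 < prob p (connEvent ends s t)ᶜ) {f g : Finset V → Finset V → ℝ}
    (hf : ∀ ⦃W W' C C' : Finset V⦄, W ⊆ W' → C' ⊆ C → f W C ≤ f W' C')
    (hg : ∀ ⦃W W' C C' : Finset V⦄, W ⊆ W' → C' ⊆ C → g W C ≤ g W' C') (X Y : Finset V) :
    0 ≤ expect p (((connEvent ends s t)ᶜ ∩ ((hitEvent ends s X)ᶜ ∪ (hitEvent ends t Y)ᶜ)).indicator
      (fun ω =>
        (f (status ends univ s t ω).1 (OrderDual.ofDual (status ends univ s t ω).2) -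
            condMean p ends univ s t (fun k => f k.1 (OrderDual.ofDual k.2))) *
          (g (status ends univ s t ω).1 (OrderDual.ofDual (status ends univ s t ω).2) -
            condMean p ends univ s t (fun k => g k.1 (OrderDual.ofDual k.2))))) :=
  hit_boxUnion_nonneg ends univ s t hp hlsm hQ hf hg (subset_univ X) (subset_univ Y)

end BoxUnionPair

end Summit.Ventures.PercRepro2
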